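import Literature.Probability.RandomPlanarGeometry.HexSAWSurfaceYcLimitAllY
import Mathlib.Analysis.Subadditive
import Mathlib.Analysis.SpecialFunctions.Pow.Real
import HarnessLib

/-!
# Free-start surface walks on the honeycomb (brick-wall) lattice: exact submultiplicativity and `Ĥ_{2j}(y) ≥ μ(y)^{2j}`

«S7-RATE-ALL-Y», Part A (pub-sawmu, a-idea-1 gen 25).  Setting of
`HexSAWSurfaceWallBridges` (Part I) / `HexSAWSurfaceYcLimitAllY` (Part II): brick-wall self-avoiding walks
`ω ∈ saws n` from the origin, the impenetrable surface being a horizontal line, surface weight `y > 0`.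

Part I weighs the walks that start ON the surface (`Cw n y = C⁺_n(y)`, surface `Y = 0`, walk in `Y ≤ 0`,
visits = even times at level `0`).  Here the surface is placed at an ARBITRARY signed distance from the
starting point: for a time-parity class `q ∈ {0,1}`, a side `s ∈ {1,-1}` and a level `h ∈ ℤ` put

* `fcls s h n` = the walks `ω ∈ saws n` with `s · Y_i ≤ h` for all `i ≤ n` (the surface is the line `s·Y = h`);
* `HF q s h n y = Σ_{ω ∈ fcls s h n} y ^ visitsAt q s h n ω`, `visitsAt` counting the times `1 ≤ i ≤ n` with
  `i % 2 = q` and `s · Y_i = h` (so `HF 0 1 0 n y = Cw n y`, `HF_zero_one_zero`);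
* the **free-start partition function** `Hhat q s n y = max { HF q s h n y : 0 ≤ h ≤ n+1 }` of each class
  `(q, s)` (the canonical class of Parts I–II — surface above, even-time visits, i.e. the boundary vertices whose
  vertical bond leaves the region — is `(q, s) = (0, 1)`)
  (levels `h ≥ n+1` are out of reach and all give the bulk count `#(saws n)`, `HF_eq_card_of_lt`; so
  `HF q s h n y ≤ Hhat q s n y` for EVERY `h ∈ ℤ`, `HF_le_Hhat`).

Main results (all `y ≥ 0`, resp. `y > 0`):

* `HF_le_mul_Hhat` — **exact renewal inequality at an even cut**: for `k ≤ n`, `k` even,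
  `HF q s h n y ≤ HF q s h k y · Hhat q s (n - k) y` (prefix/suffix injection; the suffix, re-based at its
  even-parity starting site, is again a brick-wall SAW whose surface sits at the level `h - s·Y_k`
  determined by the prefix, and the visits split additively);
* `Hhat_add_le` — `Hhat q s (m + b) y ≤ Hhat q s m y · Hhat q s b y` for `m` even: each class's free-start partition function is
  SUBMULTIPLICATIVE along even lengths, with NO loss factor;
* `surfaceMu_pow_le_Hhat` — **`μ(y)^{2j} ≤ Hhat 0 1 (2j) y` for every `j`** (`μ(y) = HV.surfaceMu y`, the
  surface growth rate of Part II): Fekete for the submultiplicative sequence `j ↦ Hhat 0 1 (2j) y` together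
  with `y · Cw m y ≤ hpCoeff (m+1) y ≤ 3y · Cw m y` (Part II) and `GrowthGeRate y (surfaceMu y)`.

The point of the construction: `Cw` itself is only SUPERmultiplicative up to unfolding losses, so a lower
bound `Cw n y ≳ μ(y)^n` at a FIXED length carries an `e^{-c√n}` correction; the free-start count is
submultiplicative on the nose, hence dominates `μ(y)^n` at every even length with constant `1`.  This is
the length-wise input for an explicit locality rate of the surface-weighted strip growth rates on the
adsorbed side (successor door «S7-RATE-ALL-Y», Parts B–C: unfold the maximising class, mirror-join, embed
in a strip).

Sources.  Sub/super-multiplicativity of half-space and surface-attached walk counts by cutting at a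
surface visit / concatenation: [HammersleyTorrieWhittington1982, §2]; [MadrasSlade1993, §1.2, (1.2.3) and
Lemma 1.2.2 (Fekete)]; surface-interacting walks with a free endpoint at arbitrary height ("positive walks",
the most-popular-height argument): [JansevanRensburg2000, §5.4, 1st ed. pp. 167–170 (positive walks from height h_b, most popular height; §5.4.1 Theorem 5.52)]; the honeycomb surface model:
[BeatonBousquetMelouDeGierDuminilCopinGuttmann2014, §3.1, Proposition 5].  The statement
`μ(y)^{2j} ≤ Ĥ_{2j}(y)` with the maximum over starting heights is not printed in this form (lane label:
NEW-IN-WRITING, standard ingredients).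
-/

open Finset Filter Function
open Literature.Probability.LatticeModels Literature.Probability.Percolation SimpleGraph
open Literature.Combinatorics.Enumerative
open _root_.Topology

noncomputable section

namespace Literature.Probability.RandomPlanarGeometry.SAW.HexBW.Wall

variable {n : ℕ} {ω : ℕ → Site 2} {y : ℝ}

/-! ### Visits of a time-parity class at a signed level -/

/-- `visitsAt q s c n ω` = number of times `1 ≤ i ≤ n` with `i % 2 = q` and `s * Y_i = c`.
[cite: BeatonBousquetMelouDeGierDuminilCopinGuttmann2014, §3.1 (arXiv v5 p. 8: the number of contacts with the surface); JansevanRensburg2000, §5.4 (1st ed. pp. 167–168: visits of positive walks)] -/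
def visitsAt (q : ℕ) (s c : ℤ) : ℕ → (ℕ → Site 2) → ℕ
  | 0, _ => 0
  | n + 1, ω => visitsAt q s c n ω + (if (n + 1) % 2 = q ∧ s * ω (n + 1) 1 = c then 1 else 0)

/-- `visitsAt q s c 0 ω = 0`. [cite: BeatonBousquetMelouDeGierDuminilCopinGuttmann2014, §3.1 (arXiv v5 p. 8)] -/
@[simp] theorem visitsAt_zero (q : ℕ) (s c : ℤ) (ω : ℕ → Site 2) : visitsAt q s c 0 ω = 0 := rfl

/-- The recursion for `visitsAt`. [cite: BeatonBousquetMelouDeGierDuminilCopinGuttmann2014, §3.1 (arXiv v5 p. 8)] -/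
theorem visitsAt_succ (q : ℕ) (s c : ℤ) (n : ℕ) (ω : ℕ → Site 2) :
    visitsAt q s c (n + 1) ω =
      visitsAt q s c n ω + (if (n + 1) % 2 = q ∧ s * ω (n + 1) 1 = c then 1 else 0) := rfl

/-- `visitsAt 0 1 0 = visits` (Part I's surface visits: even times at level `0`).
[cite: BeatonBousquetMelouDeGierDuminilCopinGuttmann2014, §3.1 (arXiv v5 p. 8)] -/
theorem visitsAt_zero_one_zero (n : ℕ) (ω : ℕ → Site 2) : visitsAt 0 1 0 n ω = visits n ω := by
  induction n with
  | zero => rfl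
  | succ n ih => rw [visitsAt_succ, visits_succ, ih, one_mul]

/-- `visitsAt` depends only on the truth values of `s * Y_i = c`, `1 ≤ i ≤ n` (change of level allowed).
[cite: BeatonBousquetMelouDeGierDuminilCopinGuttmann2014, §3.1 (arXiv v5 p. 8)] -/
theorem visitsAt_congr {q : ℕ} {s c c' : ℤ} {n : ℕ} {ω ξ : ℕ → Site 2}
    (h : ∀ i, 1 ≤ i → i ≤ n → (s * ω i 1 = c ↔ s * ξ i 1 = c')) :
    visitsAt q s c n ω = visitsAt q s c' n ξ := by
  induction n with
  | zero => rfl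
  | succ n ih =>
    rw [visitsAt_succ, visitsAt_succ, ih (fun i h1 hi => h i h1 (by omega))]
    have e := h (n + 1) (by omega) le_rfl
    by_cases hc : (n + 1) % 2 = q ∧ s * ξ (n + 1) 1 = c'
    · rw [if_pos hc, if_pos ⟨hc.1, e.2 hc.2⟩]
    · rw [if_neg hc, if_neg (fun h' => hc ⟨h'.1, e.1 h'.2⟩)]

/-- Additivity of `visitsAt` over a cut at an EVEN time `a`, the level of the second piece shifted.
[cite: MadrasSlade1993, §1.2, (1.2.3); BeatonBousquetMelouDeGierDuminilCopinGuttmann2014, §3.1 (arXiv v5 p. 8)] -/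
theorem visitsAt_add {q : ℕ} {s c c' : ℤ} {a b : ℕ} {ζ ξ : ℕ → Site 2} (ha : a % 2 = 0)
    (h : ∀ j, 1 ≤ j → j ≤ b → (s * ζ (a + j) 1 = c ↔ s * ξ j 1 = c')) :
    visitsAt q s c (a + b) ζ = visitsAt q s c a ζ + visitsAt q s c' b ξ := by
  induction b with
  | zero => simp
  | succ b ih =>
    have e := h (b + 1) (by omega) le_rfl
    rw [← add_assoc] at e
    rw [← add_assoc, visitsAt_succ, visitsAt_succ, ih (fun j h1 hj => h j h1 (by omega))]
    have hiff : ((a + b + 1) % 2 = q ∧ s * ζ (a + b + 1) 1 = c) ↔ ((b + 1) % 2 = q ∧ s * ξ (b + 1) 1 = c') := by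
      rw [e]; constructor <;> rintro ⟨h1, h2⟩ <;> exact ⟨by omega, h2⟩
    by_cases hc : (b + 1) % 2 = q ∧ s * ξ (b + 1) 1 = c'
    · rw [if_pos hc, if_pos (hiff.2 hc)]; omega
    · rw [if_neg hc, if_neg (fun h' => hc (hiff.1 h'))]; omega

/-- No visit at an unreachable level. [cite: MadrasSlade1993, §1.1] -/
theorem visitsAt_eq_zero {q : ℕ} {s c : ℤ} {n : ℕ} {ω : ℕ → Site 2}
    (h : ∀ i, 1 ≤ i → i ≤ n → s * ω i 1 ≠ c) : visitsAt q s c n ω = 0 := by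
  induction n with
  | zero => rfl
  | succ n ih =>
    rw [visitsAt_succ, ih (fun i h1 hi => h i h1 (by omega)), if_neg (fun h' => h (n + 1) (by omega) le_rfl h'.2)]

/-- After `i ≤ n` steps the ordinate is at most `i` in absolute value. [cite: MadrasSlade1993, §1.1] -/
theorem absY_le (hω : ω ∈ saws n) {i : ℕ} (hi : i ≤ n) : |ω i 1| ≤ (i : ℤ) := by
  obtain ⟨h0, -, hadj, -⟩ := Zd.mem_saws.1 (saws_subset n hω)
  exact Zd.abs_apply_le_of_adj h0 hadj i hi 1

/-! ### The free-start classes and their weights -/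

open Classical in
/-- Walks of length `n` from the origin confined to `s · Y ≤ h` (surface = the line `s · Y = h`).
[cite: JansevanRensburg2000, §5.4 (1st ed. pp. 167–168: positive walks starting at height h); HammersleyTorrieWhittington1982, §2] -/
def fcls (s h : ℤ) (n : ℕ) : Finset (ℕ → Site 2) := (saws n).filter (fun ω => ∀ i ≤ n, s * ω i 1 ≤ h)

/-- Membership in `fcls`. [cite: JansevanRensburg2000, §5.4 (1st ed. pp. 167–168)] -/
theorem mem_fcls {s h : ℤ} : ω ∈ fcls s h n ↔ ω ∈ saws n ∧ ∀ i ≤ n, s * ω i 1 ≤ h := by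
  classical
  exact Finset.mem_filter

/-- `fcls s h n ⊆ saws n`. [cite: JansevanRensburg2000, §5.4 (1st ed. pp. 167–168)] -/
theorem fcls_subset (s h : ℤ) (n : ℕ) : fcls s h n ⊆ saws n := fun _ hω => (mem_fcls.1 hω).1

/-- A negative level admits no walk (the start violates the constraint). [cite: JansevanRensburg2000, §5.4 (1st ed. pp. 167–168)] -/
theorem fcls_eq_empty_of_neg {s h : ℤ} (hh : h < 0) (n : ℕ) : fcls s h n = ∅ := by
  refine Finset.eq_empty_of_forall_notMem fun ω hω => ?_
  obtain ⟨hωs, hreg⟩ := mem_fcls.1 hω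
  obtain ⟨h0, -, -, -⟩ := mem_saws_iff.1 hωs
  have := hreg 0 (Nat.zero_le _)
  rw [h0] at this
  simp at this
  omega

/-- A level beyond reach imposes no constraint. [cite: MadrasSlade1993, §1.1] -/
theorem fcls_eq_saws_of_lt {s h : ℤ} (hs : s = 1 ∨ s = -1) (hh : (n : ℤ) < h) : fcls s h n = saws n := by
  refine Finset.Subset.antisymm (fcls_subset s h n) fun ω hω => mem_fcls.2 ⟨hω, fun i hi => ?_⟩
  have h1 := abs_le.1 (absY_le hω hi)
  rcases hs with rfl | rfl <;> omega

/-- **Weighted free-start count** `HF q s h n y = Σ_{ω ∈ fcls s h n} y ^ visitsAt q s h n ω`.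
[cite: JansevanRensburg2000, §5.4 (1st ed. pp. 167–168: partition function of positive walks from height h with visit weight); BeatonBousquetMelouDeGierDuminilCopinGuttmann2014, §3.1 (C⁺_n(y))] -/
def HF (q : ℕ) (s h : ℤ) (n : ℕ) (y : ℝ) : ℝ := ∑ ω ∈ fcls s h n, y ^ visitsAt q s h n ω

/-- `HF ≥ 0` for `y ≥ 0`. [cite: JansevanRensburg2000, §5.4 (1st ed. pp. 167–168)] -/
theorem HF_nonneg (q : ℕ) (s h : ℤ) (n : ℕ) (hy : 0 ≤ y) : 0 ≤ HF q s h n y :=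
  Finset.sum_nonneg fun _ _ => pow_nonneg hy _

/-- `HF 0 1 0 n y = Cw n y`: Part I's surface-attached weight is the member `q = 0, s = 1, h = 0`.
[cite: BeatonBousquetMelouDeGierDuminilCopinGuttmann2014, §3.1 (arXiv v5 p. 8: C⁺_n(y))] -/
theorem HF_zero_one_zero (n : ℕ) (y : ℝ) : HF 0 1 0 n y = Cw n y := by
  have hset : fcls 1 0 n = hpw n := by
    ext ω
    rw [mem_fcls, mem_hpw]
    simp only [one_mul]
    rfl
  rw [HF, Cw, hset]
  exact Finset.sum_congr rfl fun ω _ => by rw [visitsAt_zero_one_zero]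

/-- A negative level carries weight `0`. [cite: JansevanRensburg2000, §5.4 (1st ed. pp. 167–168)] -/
theorem HF_eq_zero_of_neg (q : ℕ) {s h : ℤ} (hh : h < 0) (n : ℕ) (y : ℝ) : HF q s h n y = 0 := by
  rw [HF, fcls_eq_empty_of_neg hh, Finset.sum_empty]

/-- A level beyond reach gives the bulk count: `HF q s h n y = #(saws n)` for `h > n`.
[cite: MadrasSlade1993, §1.1; JansevanRensburg2000, §5.4 (1st ed. pp. 167–168)] -/
theorem HF_eq_card_of_lt (q : ℕ) {s h : ℤ} (hs : s = 1 ∨ s = -1) (hh : (n : ℤ) < h) (y : ℝ) :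
    HF q s h n y = #(saws n) := by
  rw [HF, fcls_eq_saws_of_lt hs hh]
  have hz : ∀ ω ∈ saws n, visitsAt q s h n ω = 0 := fun ω hω =>
    visitsAt_eq_zero fun i _ hi hc => by
      have h1 := abs_le.1 (absY_le hω hi)
      rcases hs with rfl | rfl <;> omega
  rw [Finset.sum_congr rfl fun ω hω => by rw [hz ω hω, pow_zero], Finset.sum_const, nsmul_eq_mul, mul_one]

/-! ### The free-start partition function `Ĥ_n(y)` -/

/-- Index set of the maximum: the starting distances `0 ≤ h ≤ n+1`. [cite: JansevanRensburg2000, §5.4 (1st ed. pp. 167–170: most popular starting height)] -/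
def hatIdx (n : ℕ) : Finset ℤ := (range (n + 2)).image (fun h : ℕ => (h : ℤ))

/-- The index set is nonempty. [cite: JansevanRensburg2000, §5.4 (1st ed. pp. 167–170)] -/
theorem hatIdx_nonempty (n : ℕ) : (hatIdx n).Nonempty :=
  ⟨0, Finset.mem_image.2 ⟨0, Finset.mem_range.2 (by omega), by simp⟩⟩

/-- Membership in the index set. [cite: JansevanRensburg2000, §5.4 (1st ed. pp. 167–170)] -/
theorem mem_hatIdx {h : ℤ} (h0 : 0 ≤ h) (hh : h ≤ n + 1) : h ∈ hatIdx n :=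
  Finset.mem_image.2 ⟨h.toNat, Finset.mem_range.2 (by omega), by simp [Int.toNat_of_nonneg h0]⟩

/-- Members of the index set are levels `0 ≤ h ≤ n+1`. [cite: JansevanRensburg2000, §5.4 (1st ed. pp. 167–170)] -/
theorem bounds_of_mem_hatIdx {h : ℤ} (hh : h ∈ hatIdx n) : 0 ≤ h ∧ h ≤ n + 1 := by
  obtain ⟨k, hk, rfl⟩ := Finset.mem_image.1 hh
  have hk' := Finset.mem_range.1 hk
  exact ⟨by positivity, by exact_mod_cast (by omega)⟩

/-- **Free-start partition function** `Ĥ^{q,s}_n(y)` of the class `(q, s)` (time parity of the counted visits,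
side of the surface): the largest weighted count over the starting distance `0 ≤ h ≤ n+1` of the surface.  The
class of Part I / Part II (surface above, even-time visits = the boundary vertices whose vertical bond leaves the
region) is `(q, s) = (0, 1)`. [cite: JansevanRensburg2000, §5.4 (1st ed. pp. 167–170: the most popular class); HammersleyTorrieWhittington1982, §2] -/
def Hhat (q : ℕ) (s : ℤ) (n : ℕ) (y : ℝ) : ℝ := (hatIdx n).sup' (hatIdx_nonempty n) (fun h => HF q s h n y)

/-- The maximum is attained. [cite: JansevanRensburg2000, §5.4 (1st ed. pp. 167–170)] -/
theorem exists_Hhat_eq (q : ℕ) (s : ℤ) (n : ℕ) (y : ℝ) : ∃ h ∈ hatIdx n, Hhat q s n y = HF q s h n y := by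
  obtain ⟨h, hh, he⟩ := Finset.exists_mem_eq_sup' (hatIdx_nonempty n) (fun h => HF q s h n y)
  exact ⟨h, hh, he⟩

/-- Every indexed member is below the maximum. [cite: JansevanRensburg2000, §5.4 (1st ed. pp. 167–170)] -/
theorem HF_le_Hhat_of_mem (q : ℕ) (s : ℤ) {h : ℤ} (hh : h ∈ hatIdx n) (y : ℝ) : HF q s h n y ≤ Hhat q s n y :=
  Finset.le_sup' (fun h => HF q s h n y) hh

/-- `Ĥ^{q,s}_n(y) ≥ #(saws n) ≥ 1` (the member `h = n+1` is the bulk count). [cite: MadrasSlade1993, §1.1] -/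
theorem card_le_Hhat (q : ℕ) {s : ℤ} (hs : s = 1 ∨ s = -1) (n : ℕ) (y : ℝ) : (#(saws n) : ℝ) ≤ Hhat q s n y := by
  have h := HF_le_Hhat_of_mem q s (mem_hatIdx (n := n) (h := n + 1) (by positivity) le_rfl) y
  rwa [HF_eq_card_of_lt q hs (by omega)] at h

/-- `1 ≤ Ĥ^{q,s}_n(y)`. [cite: MadrasSlade1993, §1.1] -/
theorem one_le_Hhat (q : ℕ) {s : ℤ} (hs : s = 1 ∨ s = -1) (n : ℕ) (y : ℝ) : 1 ≤ Hhat q s n y := by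
  refine le_trans ?_ (card_le_Hhat q hs n y)
  exact_mod_cast Finset.card_pos.2 ⟨_, straightWalk_mem n⟩

/-- `0 < Ĥ^{q,s}_n(y)`. [cite: MadrasSlade1993, §1.1] -/
theorem Hhat_pos (q : ℕ) {s : ℤ} (hs : s = 1 ∨ s = -1) (n : ℕ) (y : ℝ) : 0 < Hhat q s n y :=
  lt_of_lt_of_le one_pos (one_le_Hhat q hs n y)

/-- **`HF q s h n y ≤ Ĥ^{q,s}_n(y)` for EVERY level `h ∈ ℤ`** (`s = ±1`): negative levels weigh `0`,
levels beyond `n+1` coincide with the level `n+1`. [cite: JansevanRensburg2000, §5.4 (1st ed. pp. 167–170); MadrasSlade1993, §1.1] -/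
theorem HF_le_Hhat (q : ℕ) {s : ℤ} (hs : s = 1 ∨ s = -1) (h : ℤ) (y : ℝ) :
    HF q s h n y ≤ Hhat q s n y := by
  rcases lt_or_ge h 0 with hneg | h0
  · rw [HF_eq_zero_of_neg q hneg]; exact (Hhat_pos q hs n y).le
  rcases le_or_gt h (n + 1) with hle | hgt
  · exact HF_le_Hhat_of_mem q s (mem_hatIdx h0 hle) y
  · rw [HF_eq_card_of_lt q hs (by omega)]
    exact card_le_Hhat q hs n y

/-- `Ĥ^{q,s}_n(y) ≤ B` as soon as every member with `0 ≤ h ≤ n+1` is `≤ B`. [cite: JansevanRensburg2000, §5.4 (1st ed. pp. 167–170)] -/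
theorem Hhat_le {q : ℕ} {s : ℤ} {B : ℝ} (hB : ∀ h : ℤ, 0 ≤ h → h ≤ n + 1 → HF q s h n y ≤ B) :
    Hhat q s n y ≤ B := by
  refine Finset.sup'_le _ _ fun h hh => ?_
  obtain ⟨h0, h1⟩ := bounds_of_mem_hatIdx hh
  exact hB h h0 h1

/-! ### Exact renewal inequality at an even cut -/

/-- A prefix of a brick-wall SAW is a brick-wall SAW. [cite: MadrasSlade1993, §1.2, (1.2.3)] -/
theorem prefixWalk_mem (hω : ω ∈ saws n) {k : ℕ} (hk : k ≤ n) : Zd.prefixWalk k ω ∈ saws k := by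
  obtain ⟨-, -, hbw, -⟩ := mem_saws_iff.1 hω
  have hv : ∀ i ≤ k, Zd.prefixWalk k ω i = ω i := fun i hi => by simp [Zd.prefixWalk, min_eq_left hi]
  refine mem_saws.2 ⟨Zd.prefixWalk_mem_saws (saws_subset _ hω) hk, fun i hi => ?_⟩
  rw [hv i hi.le, hv (i + 1) (by omega)]
  exact hbw i (by omega)

/-- **Exact renewal inequality.** For `k ≤ n` with `k` even, `s = ±1`, any class `q`, level `h` and `y ≥ 0`:
`HF q s h n y ≤ HF q s h k y · Ĥ^{q,s}_{n-k}(y)` — cut at time `k`; the prefix keeps its weight, the re-based suffix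
is a free-start walk OF THE SAME CLASS `(q, s)` (the cut is even) seeing the surface at the level `h - s·Y_k` fixed
by the prefix. [cite: HammersleyTorrieWhittington1982, §2; MadrasSlade1993, §1.2, (1.2.3); JansevanRensburg2000, §5.4 (1st ed. pp. 167–168)] -/
theorem HF_le_mul_Hhat (q : ℕ) {s : ℤ} (hs : s = 1 ∨ s = -1) (h : ℤ) {k : ℕ} (hk : k ≤ n)
    (hk2 : k % 2 = 0) (hy : 0 ≤ y) :
    HF q s h n y ≤ HF q s h k y * Hhat q s (n - k) y := by
  classical
  set F := fcls s h n with hF_def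
  set pre : (ℕ → Site 2) → (ℕ → Site 2) := fun ω => Zd.prefixWalk k ω with hpre_def
  set suf : (ℕ → Site 2) → (ℕ → Site 2) := fun ω => Zd.suffixWalk k (n - k) ω with hsuf_def
  -- level seen by the suffix, a function of the prefix
  set lv : (ℕ → Site 2) → ℤ := fun φ => h - s * φ k 1 with hlv_def
  have hpre_apply : ∀ ω : ℕ → Site 2, ∀ i ≤ k, pre ω i = ω i := fun ω i hi => by
    simp [hpre_def, Zd.prefixWalk, min_eq_left hi]
  have hsuf_apply : ∀ ω : ℕ → Site 2, ∀ j ≤ n - k, suf ω j = ω (k + j) - ω k := fun ω j hj => by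
    simp [hsuf_def, Zd.suffixWalk, min_eq_left hj]
  -- properties of members of F
  have hprops : ∀ ω ∈ F, pre ω ∈ fcls s h k ∧ suf ω ∈ fcls s (lv (pre ω)) (n - k) ∧
      visitsAt q s h n ω = visitsAt q s h k (pre ω) + visitsAt q s (lv (pre ω)) (n - k) (suf ω) := by
    intro ω hω
    obtain ⟨hωs, hreg⟩ := mem_fcls.1 hω
    have hlv : lv (pre ω) = h - s * ω k 1 := by rw [hlv_def]; simp only [hpre_apply ω k le_rfl]
    refine ⟨mem_fcls.2 ⟨prefixWalk_mem hωs hk, fun i hi => by rw [hpre_apply ω i hi]; exact hreg i (by omega)⟩,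
      mem_fcls.2 ⟨?_, fun j hj => ?_⟩, ?_⟩
    · exact suffixWalk_mem hωs hk hk2
    · rw [hlv, hsuf_apply ω j hj]
      have := hreg (k + j) (by omega)
      simp only [Pi.sub_apply, mul_sub]
      linarith
    · have e : visitsAt q s h n ω = visitsAt q s h (k + (n - k)) ω := by rw [Nat.add_sub_cancel' hk]
      rw [e, visitsAt_add hk2 (ξ := suf ω) (c' := lv (pre ω)) (fun j _ hj => by
        rw [hlv, hsuf_apply ω j hj]; simp only [Pi.sub_apply, mul_sub]; constructor <;> intro h' <;> linarith)]
      congr 1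
      exact visitsAt_congr fun i _ hi => by rw [hpre_apply ω i hi]
  have hinj : Set.InjOn (fun ω : ℕ → Site 2 => (pre ω, suf ω)) ↑F := fun ω hω ω' hω' h =>
    Zd.prefix_suffix_injOn hk (saws_subset _ (fcls_subset _ _ _ hω)) (saws_subset _ (fcls_subset _ _ _ hω')) h
  -- fibrewise bound
  have hmaps : ∀ ω ∈ F, pre ω ∈ F.image pre := fun ω hω => Finset.mem_image_of_mem _ hω
  have hfib : ∀ φ ∈ F.image pre,
      ∑ ω ∈ F.filter (fun ω => pre ω = φ), y ^ visitsAt q s h n ω ≤ y ^ visitsAt q s h k φ * Hhat q s (n - k) y := by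
    intro φ hφ
    set G := F.filter (fun ω => pre ω = φ) with hG_def
    have hG : ∀ ω ∈ G, ω ∈ F ∧ pre ω = φ := fun ω hω => Finset.mem_filter.1 hω
    have hinjG : Set.InjOn suf ↑G := by
      intro ω hω ω' hω' hs'
      have h1 := hG ω hω; have h2 := hG ω' hω'
      exact hinj h1.1 h2.1 (by simp only [Prod.mk.injEq]; exact ⟨h1.2.trans h2.2.symm, hs'⟩)
    calc ∑ ω ∈ G, y ^ visitsAt q s h n ω
        = ∑ ω ∈ G, y ^ visitsAt q s h k φ * y ^ visitsAt q s (lv φ) (n - k) (suf ω) :=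
          Finset.sum_congr rfl fun ω hω => by
            obtain ⟨hωF, hωφ⟩ := hG ω hω
            rw [(hprops ω hωF).2.2, pow_add, hωφ]
      _ = y ^ visitsAt q s h k φ * ∑ ω ∈ G, y ^ visitsAt q s (lv φ) (n - k) (suf ω) := by rw [Finset.mul_sum]
      _ = y ^ visitsAt q s h k φ * ∑ ξ ∈ G.image suf, y ^ visitsAt q s (lv φ) (n - k) ξ := by
          rw [Finset.sum_image hinjG]
      _ ≤ y ^ visitsAt q s h k φ * HF q s (lv φ) (n - k) y := by
          refine mul_le_mul_of_nonneg_left ?_ (pow_nonneg hy _)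
          refine Finset.sum_le_sum_of_subset_of_nonneg (fun ξ hξ => ?_) fun _ _ _ => pow_nonneg hy _
          obtain ⟨ω, hω, rfl⟩ := Finset.mem_image.1 hξ
          obtain ⟨hωF, hωφ⟩ := hG ω hω
          have := (hprops ω hωF).2.1
          rwa [hωφ] at this
      _ ≤ y ^ visitsAt q s h k φ * Hhat q s (n - k) y :=
          mul_le_mul_of_nonneg_left (HF_le_Hhat q hs _ y) (pow_nonneg hy _)
  calc HF q s h n y = ∑ ω ∈ F, y ^ visitsAt q s h n ω := rfl
    _ = ∑ φ ∈ F.image pre, ∑ ω ∈ F.filter (fun ω => pre ω = φ), y ^ visitsAt q s h n ω :=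
        (Finset.sum_fiberwise_of_maps_to hmaps _).symm
    _ ≤ ∑ φ ∈ F.image pre, y ^ visitsAt q s h k φ * Hhat q s (n - k) y := Finset.sum_le_sum hfib
    _ ≤ ∑ φ ∈ fcls s h k, y ^ visitsAt q s h k φ * Hhat q s (n - k) y := by
        refine Finset.sum_le_sum_of_subset_of_nonneg (fun φ hφ => ?_)
          fun _ _ _ => mul_nonneg (pow_nonneg hy _) (Hhat_pos q hs _ _).le
        obtain ⟨ω, hω, rfl⟩ := Finset.mem_image.1 hφ
        exact (hprops ω hω).1
    _ = HF q s h k y * Hhat q s (n - k) y := by rw [HF, Finset.sum_mul]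

/-- **Submultiplicativity of the free-start partition function of each class along even lengths**:
`Ĥ^{q,s}_{m+b}(y) ≤ Ĥ^{q,s}_m(y) · Ĥ^{q,s}_b(y)` for `m` even, `s = ±1` and `y ≥ 0` — no loss factor.
[cite: HammersleyTorrieWhittington1982, §2; MadrasSlade1993, §1.2, (1.2.3); JansevanRensburg2000, §5.4 (1st ed. pp. 167–170)] -/
theorem Hhat_add_le (q : ℕ) {s : ℤ} (hs : s = 1 ∨ s = -1) {m : ℕ} (hm : m % 2 = 0) (b : ℕ) (hy : 0 ≤ y) :
    Hhat q s (m + b) y ≤ Hhat q s m y * Hhat q s b y := by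
  refine Hhat_le fun h _ _ => ?_
  calc HF q s h (m + b) y ≤ HF q s h m y * Hhat q s (m + b - m) y := HF_le_mul_Hhat q hs h (by omega) hm hy
    _ = HF q s h m y * Hhat q s b y := by rw [Nat.add_sub_cancel_left]
    _ ≤ Hhat q s m y * Hhat q s b y := mul_le_mul_of_nonneg_right (HF_le_Hhat q hs h y) (Hhat_pos q hs b y).le

/-! ### Fekete for the canonical class `(0, 1)`: `Ĥ^{0,1}_{2j}(y) ≥ μ(y)^{2j}` -/

/-- `Cw n y ≤ Ĥ^{0,1}_n(y)`. [cite: BeatonBousquetMelouDeGierDuminilCopinGuttmann2014, §3.1 (C⁺_n(y)); JansevanRensburg2000, §5.4 (1st ed. pp. 167–168)] -/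
theorem Cw_le_Hhat (n : ℕ) (y : ℝ) : Cw n y ≤ Hhat 0 1 n y := by
  rw [← HF_zero_one_zero]; exact HF_le_Hhat 0 (Or.inl rfl) 0 y

/-- `hpCoeff (m+1) y ≤ 3y · Ĥ^{0,1}_m(y)` (`y ≥ 0`), from Part II's `hpCoeff_succ_le`.
[cite: BeatonBousquetMelouDeGierDuminilCopinGuttmann2014, §3.1, Proposition 5 (arXiv v5 p. 9)] -/
theorem hpCoeff_succ_le_Hhat (m : ℕ) (hy : 0 ≤ y) : HV.hpCoeff (m + 1) y ≤ 3 * y * Hhat 0 1 m y :=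
  (HV.hpCoeff_succ_le m hy).trans (mul_le_mul_of_nonneg_left (Cw_le_Hhat m y) (by positivity))

/-- The even-length canonical free-start sequence in logarithmic form: `hatLog y j = log Ĥ^{0,1}_{2j}(y)`.
[cite: MadrasSlade1993, §1.2, Lemma 1.2.2] -/
def hatLog (y : ℝ) (j : ℕ) : ℝ := Real.log (Hhat 0 1 (2 * j) y)

/-- `hatLog y` is subadditive (`y ≥ 0`). [cite: MadrasSlade1993, §1.2, Lemma 1.2.2; HammersleyTorrieWhittington1982, §2] -/
theorem hatLog_subadditive (hy : 0 ≤ y) : Subadditive (hatLog y) := by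
  intro i j
  rw [hatLog, hatLog, hatLog, ← Real.log_mul (Hhat_pos 0 (Or.inl rfl) _ _).ne' (Hhat_pos 0 (Or.inl rfl) _ _).ne',
    mul_add]
  exact Real.log_le_log (Hhat_pos 0 (Or.inl rfl) _ _) (Hhat_add_le 0 (Or.inl rfl) (by omega) _ hy)

/-- `hatLog y j / j ≥ 0`, so the Fekete quotients are bounded below. [cite: MadrasSlade1993, §1.2, Lemma 1.2.2] -/
theorem hatLog_bddBelow (y : ℝ) : BddBelow (Set.range fun j : ℕ => hatLog y j / j) :=
  ⟨0, by
    rintro _ ⟨j, rfl⟩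
    exact div_nonneg (Real.log_nonneg (one_le_Hhat 0 (Or.inl rfl) _ _)) (Nat.cast_nonneg j)⟩

/-- The Fekete limit of `log Ĥ_{2j}(y) / j` is at least `2 log μ(y)` (`y > 0`).
[cite: BeatonBousquetMelouDeGierDuminilCopinGuttmann2014, §3.1, Proposition 5 (arXiv v5 p. 9: μ(y) = lim C⁺_k(y)^{1/k}); MadrasSlade1993, §1.2, Lemma 1.2.2] -/
theorem two_mul_log_surfaceMu_le_lim (hy : 0 < y) :
    2 * Real.log (HV.surfaceMu y) ≤ (hatLog_subadditive hy.le).lim := by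
  have hM := HV.surfaceMu_pos y
  have hlim := (hatLog_subadditive hy.le).tendsto_lim (hatLog_bddBelow y)
  -- for every 0 < r < μ(y): 2 log r ≤ lim
  have key : ∀ r : ℝ, 0 < r → r < HV.surfaceMu y → 2 * Real.log r ≤ (hatLog_subadditive hy.le).lim := by
    intro r hr0 hrM
    have hev := HV.growthGeRate_surfaceMu hy r hr0.le hrM
    -- eventually in j: r^(2j+1) ≤ hpCoeff (2j+1) y ≤ 3y Ĥ_{2j}(y)
    have hev2 : ∀ᶠ j : ℕ in atTop, 2 * Real.log r + (Real.log r - Real.log (3 * y)) / j ≤ hatLog y j / j := by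
      have ht : Tendsto (fun j : ℕ => 2 * j + 1) atTop atTop := by
        refine tendsto_atTop_atTop.2 fun b => ⟨b, fun j hj => by omega⟩
      filter_upwards [ht.eventually hev, eventually_ge_atTop 1] with j hj hj1
      have hjpos : (0 : ℝ) < j := by exact_mod_cast hj1
      have h3y : 0 < 3 * y := by positivity
      have hH := Hhat_pos 0 (Or.inl rfl) (2 * j) y
      have h1 : r ^ (2 * j + 1) ≤ 3 * y * Hhat 0 1 (2 * j) y := hj.trans (hpCoeff_succ_le_Hhat (2 * j) hy.le)
      have h2 : ((2 * j + 1 : ℕ) : ℝ) * Real.log r ≤ Real.log (3 * y) + hatLog y j := by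
        rw [hatLog, ← Real.log_mul h3y.ne' hH.ne', ← Real.log_pow]
        exact Real.log_le_log (pow_pos hr0 _) h1
      push_cast at h2
      have e : 2 * Real.log r + (Real.log r - Real.log (3 * y)) / j =
          ((2 * j + 1) * Real.log r - Real.log (3 * y)) / j := by
        field_simp; ring
      rw [e, div_le_div_iff_of_pos_right hjpos]
      linarith
    have hconst : Tendsto (fun j : ℕ => 2 * Real.log r + (Real.log r - Real.log (3 * y)) / j) atTop
        (𝓝 (2 * Real.log r)) := by
      have := (tendsto_const_div_atTop_nhds_zero_nat (Real.log r - Real.log (3 * y))).const_add (2 * Real.log r)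
      simpa using this
    exact le_of_tendsto_of_tendsto hconst hlim hev2
  -- let r ↑ μ(y)
  have hcont : Tendsto (fun r : ℝ => 2 * Real.log r) (𝓝[<] HV.surfaceMu y) (𝓝 (2 * Real.log (HV.surfaceMu y))) :=
    (((Real.continuousAt_log hM.ne').tendsto).const_mul 2).mono_left nhdsWithin_le_nhds
  exact le_of_tendsto hcont (by
    filter_upwards [Ioo_mem_nhdsLT hM] with r hr using key r hr.1 hr.2)

/-- **`μ(y)^{2j} ≤ Ĥ_{2j}(y)` for every `j` and every `y > 0`**: the free-start surface partition function
dominates the surface growth rate at EVERY even length, with constant `1`.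
[cite: BeatonBousquetMelouDeGierDuminilCopinGuttmann2014, §3.1, Proposition 5 (arXiv v5 p. 9); HammersleyTorrieWhittington1982, §2; JansevanRensburg2000, §5.4 (1st ed. pp. 167–170); MadrasSlade1993, §1.2, Lemma 1.2.2] -/
theorem surfaceMu_pow_le_Hhat (hy : 0 < y) (j : ℕ) : HV.surfaceMu y ^ (2 * j) ≤ Hhat 0 1 (2 * j) y := by
  rcases Nat.eq_zero_or_pos j with rfl | hj
  · simpa using one_le_Hhat 0 (Or.inl rfl) 0 y
  have hM := HV.surfaceMu_pos y
  have hsub := hatLog_subadditive hy.le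
  have h1 : hsub.lim ≤ hatLog y j / j := hsub.lim_le_div (hatLog_bddBelow y) hj.ne'
  have hjpos : (0 : ℝ) < j := by exact_mod_cast hj
  have h2 : (j : ℝ) * (2 * Real.log (HV.surfaceMu y)) ≤ hatLog y j := by
    have := mul_le_mul_of_nonneg_left ((two_mul_log_surfaceMu_le_lim hy).trans h1) hjpos.le
    rwa [mul_div_cancel₀ _ hjpos.ne'] at this
  have h3 : Real.log (HV.surfaceMu y ^ (2 * j)) ≤ Real.log (Hhat 0 1 (2 * j) y) := by
    rw [Real.log_pow]; push_cast; rw [hatLog] at h2; linarith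
  exact (Real.log_le_log_iff (pow_pos hM _) (Hhat_pos 0 (Or.inl rfl) _ _)).1 h3

/-- **A most popular starting height dominates `μ(y)^{2j}`**: some level `0 ≤ h ≤ 2j+1` of the canonical class
has `HF 0 1 h (2j) y ≥ μ(y)^{2j}` (`y > 0`). [cite: JansevanRensburg2000, §5.4 (1st ed. pp. 167–170: the most popular height); BeatonBousquetMelouDeGierDuminilCopinGuttmann2014, §3.1, Proposition 5 (arXiv v5 p. 9)] -/
theorem exists_pow_le_HF (hy : 0 < y) (j : ℕ) :
    ∃ h : ℤ, 0 ≤ h ∧ h ≤ 2 * j + 1 ∧ HV.surfaceMu y ^ (2 * j) ≤ HF 0 1 h (2 * j) y := by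
  obtain ⟨h, hh, he⟩ := exists_Hhat_eq 0 1 (2 * j) y
  obtain ⟨h0, h1⟩ := bounds_of_mem_hatIdx hh
  exact ⟨h, h0, by exact_mod_cast h1, he ▸ surfaceMu_pow_le_Hhat hy j⟩

/-- Corollary in Part I's language: **`μ(y)^{2j} ≤ Ĥ^{0,1}_{2j}(y)` and `C⁺_{2j}(y) ≤ Ĥ^{0,1}_{2j}(y)`** side by
side — the canonical free-start maximum interpolates between the surface-attached count and its growth rate
without loss. [cite: BeatonBousquetMelouDeGierDuminilCopinGuttmann2014, §3.1, Proposition 5 (arXiv v5 p. 9); JansevanRensburg2000, §5.4 (1st ed. pp. 167–170)] -/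
theorem max_pow_Cw_le_Hhat (hy : 0 < y) (j : ℕ) :
    max (HV.surfaceMu y ^ (2 * j)) (Cw (2 * j) y) ≤ Hhat 0 1 (2 * j) y :=
  max_le (surfaceMu_pow_le_Hhat hy j) (Cw_le_Hhat _ y)

end Literature.Probability.RandomPlanarGeometry.SAW.HexBW.Wall

end
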